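import Mathlib
import Literature.Analysis.ODE.RationalTaylorMajorant
import Literature.Analysis.ODE.RegularSingularLogBranchScalar
import Literature.MathematicalPhysics.MHD.TearingOuterRegion
import HarnessLib

/-!
# F3.r3 instance «TearingFRS1»: the scaled marginal tearing equation of the printed peaked profile and
# its resonant normal form at the rational surface, with the Frobenius data PROVED admissible

LADDER-GRIDFUSION rung F3.r3 (lead RULING 2026-08-26T21:35:45Z: first cylindrical `Δ′` certificate =
instability-side on the printed profile), instance card `models/F3-SCOPING.md` §7 (model-6). MODEL M (MODELLED column):
straight cylinder, zero β, uniform `B_z`, single helicity; safety-factor profile `q(r) = q₀(1 + λ r²/r_a²)` with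
`q₀ = 7/5`, `λ = 1` — the profile PRINTED in Ham–Connor–Cowley–Hastie–Hender–Liu, arXiv:1308.2070 §4 («`q₀ = 1.4` and
`λ = 1` … `q_a = 2.8`»; bib `HamEtAl2013`), equivalently the `ν = 1` peaked current `j ∝ (1 + r²/r₀²)⁻²` of
Furth–Rutherford–Selberg 1973; mode `(m, n) = (2, 1)`, rational surface `r_s² = (m/(n q₀) − 1)/λ · r_a² = (3/7) r_a²`.
In the scaled radius `u = r/r_s` ALL local data are rational although `r_s` is not: the marginal outer equation
[Miyamoto, *Controlled Fusion and Plasma Physics* (2007) §9.4.1 eq. (9.61); tree predicate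
`Literature.MathematicalPhysics.MHD.Tearing.IsCylOuterSolution`] becomes

  `ψ_uu + ψ_u/u − 4ψ/u² − 560 ψ/((7 + 3u²)²(u² − 1)) = 0`   (`IsScaledOuterSolution`),

and at the surface `u = 1 + x`, after multiplication by `x`, the resonant normal form `x ψ″ + p(x) ψ′ + q(x) ψ = 0` with
`p = x/(1 + x) = P₁/Q₁` and `q = P/Q` (explicit degree-6 / degree-7 polynomials, `Q(0) = 1`, `q(0) = −14/5`, so the
logarithmic coefficient of the large solution is `κ = 14/5 ≠ 0`).

THIS FILE (step (1) of the §7 pipeline; no kit job involved): the polynomials and their elementary facts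
(`Q_coeff_zero`, degree bounds by `compute_degree`, the denominator MARGIN `Σ_{j≥1}|Q_j| 8⁻ʲ ≤ 4/7 < 1` and numerator
sum `≤ 21/5` at `ρ = 1/8`, by `norm_num`); the Taylor data `pc`, `qc` of `p`, `q` by the division recursion of
`Literature/Analysis/ODE/RationalTaylorMajorant.lean` with the bounds `|pc n|, |qc n| ≤ (49/5)·8ⁿ` and the sums on
`|x| < 1/8` (`p_taylor`, `q_taylor`); hence **`isScalarLogData : IsScalarLogData pc qc p q 8 (49/5) (1/8)`** — the
hypotheses of `RegularSingularLogBranchScalar.lean` / `RegularSingularSharpRadius.lean` for this instance, so the small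
solution `ψ_s = x + …` and the large solution `ψ_L = (14/5) log|x| ψ_s + η` EXIST with explicit majorants on both sides
of the surface; the closed form `q_eq`; and `local_normal_form`, the algebraic identity tying the normal form to the
model right-hand side. CERTIFIED column so far: nothing about `Δ′` yet (steps (2)–(8) of the card: exact jets, sharp
radius, validated outer solves, matchings, `Tearing.isDeltaPrime_of_logBranch`); VALIDATED preview (float, seat):
`r_s Δ′ ≈ +5.1`. MODEL-VALIDITY row: MV-7R (plan/MODEL-VALIDITY.md).
-/

noncomputable section

open Finset Filter Metric Polynomial
open scoped Topology

namespace Summit.Ventures.FusionMHD.Models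

namespace TearingFRS1

/-! ### The local coefficient data at the rational surface `u = 1` (`x = u − 1`) -/

/-- Numerator of `p(x) = x/(1 + x)`. [folklore] -/
def P₁ : ℝ[X] := X

/-- Denominator of `p(x) = x/(1 + x)` (`Q₁(0) = 1`). [folklore] -/
def Q₁ : ℝ[X] := 1 + X

/-- Denominator of `q(x)`: `Q = (1+x)²(3x²+6x+10)²(x+2)/200`, normalised to `Q(0) = 1`. [folklore] -/
def Q : ℝ[X] :=
  1 + C (37 / 10) * X + C (149 / 25) * X ^ 2 + C (283 / 50) * X ^ 3 + C (351 / 100) * X ^ 4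
    + C (57 / 40) * X ^ 5 + C (9 / 25) * X ^ 6 + C (9 / 200) * X ^ 7

/-- Numerator of `q(x)`: `P = (−4x(3x²+6x+10)²(x+2) − 560(1+x)²)/200`. [folklore] -/
def P : ℝ[X] :=
  C (-14 / 5) + C (-48 / 5) * X + C (-48 / 5) * X ^ 2 + C (-156 / 25) * X ^ 3 + C (-84 / 25) * X ^ 4
    + C (-27 / 25) * X ^ 5 + C (-9 / 50) * X ^ 6

/-- `Q₁(0) = 1`. [folklore] -/
theorem Q₁_coeff_zero : Q₁.coeff 0 = 1 := by simp [Q₁]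

/-- `Q(0) = 1` (normalised denominator). [folklore] -/
theorem Q_coeff_zero : Q.coeff 0 = 1 := by simp [Q]

/-- `deg Q₁ ≤ 1`. [folklore] -/
theorem Q₁_natDegree_le : Q₁.natDegree ≤ 1 := by unfold Q₁; compute_degree

/-- `deg P₁ ≤ 1`. [folklore] -/
theorem P₁_natDegree_le : P₁.natDegree ≤ 1 := by unfold P₁; compute_degree

/-- `deg Q ≤ 7`. [folklore] -/
theorem Q_natDegree_le : Q.natDegree ≤ 7 := by unfold Q; compute_degree

/-- `deg P ≤ 6`. [folklore] -/
theorem P_natDegree_le : P.natDegree ≤ 6 := by unfold P; compute_degree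

/-- denominator margin of `Q₁` at `ρ = 1/8`: `Σ_{j<1} |Q₁_{j+1}| ρ^{j+1} = 1/8`. [folklore] -/
theorem Q₁_margin : ∑ j ∈ range 1, ‖Q₁.coeff (j + 1)‖ * (1 / 8 : ℝ) ^ (j + 1) ≤ 1 / 8 := by
  simp [Q₁, coeff_one, coeff_X]

/-- numerator sum of `P₁` at `ρ = 1/8`: `= 1/8`. [folklore] -/
theorem P₁_sum : ∑ i ∈ range (1 + 1), ‖P₁.coeff i‖ * (1 / 8 : ℝ) ^ i ≤ 1 / 8 := by
  simp [P₁, Finset.sum_range_succ, coeff_X]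

/-- denominator margin of `Q` at `ρ = 1/8`: `Σ_{j<7} |Q_{j+1}| ρ^{j+1} ≤ 4/7` (exact value `0.56758…`). [folklore] -/
theorem Q_margin : ∑ j ∈ range 7, ‖Q.coeff (j + 1)‖ * (1 / 8 : ℝ) ^ (j + 1) ≤ 4 / 7 := by
  simp only [Q, Finset.sum_range_succ, Finset.sum_range_zero, coeff_add, coeff_C_mul, coeff_X_pow, coeff_one,
    coeff_X]
  norm_num

/-- numerator sum of `P` at `ρ = 1/8`: `≤ 21/5` (exact value `4.1630…`). [folklore] -/
theorem P_sum : ∑ i ∈ range (6 + 1), ‖P.coeff i‖ * (1 / 8 : ℝ) ^ i ≤ 21 / 5 := by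
  simp only [P, Finset.sum_range_succ, Finset.sum_range_zero, coeff_add, coeff_C_mul, coeff_X_pow,
    coeff_X]
  norm_num

/-! ### Taylor data of `p = P₁/Q₁` and `q = P/Q` (division recursion + majorant + convergence) -/

/-- The coefficient sequence of `p(x) = x/(1+x)`: `pc = ratTaylorCoeff X (1 + X)` (= `0, 1, −1, 1, …`). [folklore] -/
def pc : ℕ → ℝ := Literature.Analysis.ODE.ratTaylorCoeff P₁ Q₁

/-- The coefficient sequence of `q = P/Q` (= `−14/5, 19/25, 1069/250, …`). [folklore] -/
def qc : ℕ → ℝ := Literature.Analysis.ODE.ratTaylorCoeff P Q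

/-- `p(x) = x/(1 + x)`. [folklore] -/
def p (x : ℝ) : ℝ := x / (1 + x)

/-- `q(x) = P(x)/Q(x)` (= `−4x/(1+x)² − 560/((3x²+6x+10)²(x+2))`, see `q_eq`). [folklore] -/
def q (x : ℝ) : ℝ := P.eval x / Q.eval x

/-- Taylor data of `p`: `|pc n| ≤ (1/7)·8ⁿ` and `Σ xⁿ pc n = x/(1+x)` on `|x| < 1/8`. [folklore] -/
theorem p_taylor : (∀ n, ‖pc n‖ ≤ (1 / 8) / (1 - 1 / 8) * (1 / 8 : ℝ)⁻¹ ^ n) ∧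
    ∀ x : ℝ, ‖x‖ < 1 / 8 → Q₁.eval x ≠ 0 ∧ HasSum (fun n => x ^ n * pc n) (P₁.eval x / Q₁.eval x) :=
  Literature.Analysis.ODE.ratTaylor_of_natDegree_le P₁ Q₁ Q₁_coeff_zero (by norm_num) Q₁_natDegree_le
    P₁_natDegree_le Q₁_margin (by norm_num) P₁_sum

/-- Taylor data of `q`: `|qc n| ≤ (49/5)·8ⁿ` and `Σ xⁿ qc n = P(x)/Q(x)` on `|x| < 1/8`. [folklore] -/
theorem q_taylor : (∀ n, ‖qc n‖ ≤ (21 / 5) / (1 - 4 / 7) * (1 / 8 : ℝ)⁻¹ ^ n) ∧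
    ∀ x : ℝ, ‖x‖ < 1 / 8 → Q.eval x ≠ 0 ∧ HasSum (fun n => x ^ n * qc n) (P.eval x / Q.eval x) :=
  Literature.Analysis.ODE.ratTaylor_of_natDegree_le P Q Q_coeff_zero (by norm_num) Q_natDegree_le
    P_natDegree_le Q_margin (by norm_num) P_sum

/-- `pc 0 = 0`: `p(0) = 0`, i.e. the indicial exponents are `{0, 1}`. [folklore] -/
theorem pc_zero : pc 0 = 0 := by
  rw [pc, Literature.Analysis.ODE.ratTaylorCoeff_eq]
  simp [P₁]

/-- `qc 0 = −14/5`: `q₀ = −14/5`, so the logarithmic coefficient is `κ = −q₀ = 14/5 ≠ 0`. [folklore] -/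
theorem qc_zero : qc 0 = -14 / 5 := by
  rw [qc, Literature.Analysis.ODE.ratTaylorCoeff_eq]
  simp [P]

/-- **THE LOCAL DATA ARE ADMISSIBLE**: `IsScalarLogData pc qc p q 8 (49/5) (1/8)` — the hypotheses of the
logarithmic-branch theorems (`RegularSingularLogBranchScalar.lean`, `RegularSingularSharpRadius.lean`) hold for the
local tearing equation `x ψ″ + p ψ′ + q ψ = 0` of this instance, from polynomial arithmetic alone. [instance] -/
theorem isScalarLogData : Literature.Analysis.ODE.IsScalarLogData pc qc p q 8 (49 / 5) (1 / 8) where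
  a_pos := by norm_num
  K_nonneg := by norm_num
  ρ₀_pos := by norm_num
  norm_pc_le k _ := by
    have h := p_taylor.1 k
    have h8 : (1 / 8 : ℝ)⁻¹ = 8 := by norm_num
    rw [h8] at h
    refine h.trans (mul_le_mul_of_nonneg_right (by norm_num) (by positivity))
  norm_qc_le k _ := by
    have h := q_taylor.1 k
    have h8 : (1 / 8 : ℝ)⁻¹ = 8 := by norm_num
    rw [h8] at h
    refine h.trans (mul_le_mul_of_nonneg_right (by norm_num) (by positivity))
  pc_zero := pc_zero
  hasSum_p x hx := by
    have h := (p_taylor.2 x hx).2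
    have he : P₁.eval x / Q₁.eval x = p x := by simp [P₁, Q₁, p]
    rwa [he] at h
  hasSum_q x hx := (q_taylor.2 x hx).2

/-! ### Closed forms and the link with the scaled model equation -/

/-- `Q(x) = (1+x)²(3x²+6x+10)²(x+2)/200`. [folklore] -/
theorem Q_eval (x : ℝ) : Q.eval x = (1 + x) ^ 2 * (3 * x ^ 2 + 6 * x + 10) ^ 2 * (x + 2) / 200 := by
  simp only [Q, eval_add, eval_mul, eval_C, eval_X, eval_pow, eval_one]
  ring

/-- `P(x) = (−4x(3x²+6x+10)²(x+2) − 560(1+x)²)/200`. [folklore] -/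
theorem P_eval (x : ℝ) : P.eval x = (-4 * x * (3 * x ^ 2 + 6 * x + 10) ^ 2 * (x + 2) - 560 * (1 + x) ^ 2) / 200 := by
  simp only [P, eval_add, eval_mul, eval_C, eval_X, eval_pow]
  ring

/-- `Q(x) ≠ 0` away from `x = −1` (the axis `u = 0`) and `x = −2` (the mirror surface `u = −1`). [folklore] -/
theorem Q_eval_ne_zero {x : ℝ} (hx1 : 1 + x ≠ 0) (hx2 : x + 2 ≠ 0) : Q.eval x ≠ 0 := by
  rw [Q_eval]
  have h3 : (3 * x ^ 2 + 6 * x + 10 : ℝ) ≠ 0 := by nlinarith [sq_nonneg (x + 1)]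
  positivity

/-- CLOSED FORM of the local coefficient: `q(x) = −4x/(1+x)² − 560/((3x²+6x+10)²(x+2))` (away from `x = −1, −2`).
[folklore] -/
theorem q_eq {x : ℝ} (hx1 : 1 + x ≠ 0) (hx2 : x + 2 ≠ 0) :
    q x = -4 * x / (1 + x) ^ 2 - 560 / ((3 * x ^ 2 + 6 * x + 10) ^ 2 * (x + 2)) := by
  have h3 : (3 * x ^ 2 + 6 * x + 10 : ℝ) ≠ 0 := by nlinarith [sq_nonneg (x + 1)]
  have hQ := Q_eval_ne_zero hx1 hx2
  rw [q, div_eq_iff hQ, P_eval, Q_eval]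
  set t : ℝ := 3 * x ^ 2 + 6 * x + 10 with ht
  field_simp

/-- **The scaled marginal tearing equation of the instance** (MODEL M, in `u = r/r_s`): `ψ_uu + ψ_u/u − 4ψ/u²
+ C(u) ψ = 0` with `C(u) = r_s² · (m μ₀ j′/(B_θ(nq − m)))(r_s u) = −560/((7 + 3u²)²(u² − 1))` for the profile
`q(r) = (7/5)(1 + r²/r_a²)` (⇔ `j ∝ (1 + r²/r_a²)⁻²`, the `ν = 1` peaked profile), `(m, n) = (2, 1)`, `r_s² = (3/7) r_a²`;
first-order form `ψ′ = ψ'`, `ψ'′ = −ψ'/u + (4/u² + 560/((7+3u²)²(u²−1))) ψ` on a set avoiding `u ∈ {0, ±1}`. This is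
`Literature.MathematicalPhysics.MHD.Tearing.IsCylOuterSolution` [Miyamoto2007 §9.4.1 eq. (9.61)] written out for this
profile and rescaled (derivation: models/F3-SCOPING.md §7; MODELLED: zero β, straight cylinder, single helicity).
[model instance predicate — OUR object, not a cited statement] -/
def IsScaledOuterSolution (ψ ψ' : ℝ → ℝ) (s : Set ℝ) : Prop :=
  ∀ u ∈ s, HasDerivAt ψ (ψ' u) u ∧
    HasDerivAt ψ' (-(ψ' u) / u + (4 / u ^ 2 + 560 / ((7 + 3 * u ^ 2) ^ 2 * (u ^ 2 - 1))) * ψ u) u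

/-- THE LOCAL NORMAL FORM: at `u = 1 + x` (`x ∉ {0, −1, −2}`) the right-hand side of the scaled equation is the unique
`D` with `x D + p(x) ψ' + q(x) ψ = 0` — i.e. multiplying the model equation by `x = u − 1` gives exactly the resonant
normal form `x ψ″ + p ψ′ + q ψ = 0` of `IsScalarLogData` with the data `pc, qc` above. [folklore] -/
theorem local_normal_form {x ψ₀ ψ₁ D : ℝ} (hx0 : x ≠ 0) (hx1 : 1 + x ≠ 0) (hx2 : x + 2 ≠ 0) :
    x * D + p x * ψ₁ + q x * ψ₀ = 0 ↔
      D = -ψ₁ / (1 + x) + (4 / (1 + x) ^ 2 + 560 / ((7 + 3 * (1 + x) ^ 2) ^ 2 * ((1 + x) ^ 2 - 1))) * ψ₀ := by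
  have h3 : (3 * x ^ 2 + 6 * x + 10 : ℝ) ≠ 0 := by nlinarith [sq_nonneg (x + 1)]
  have h7 : (7 + 3 * (1 + x) ^ 2 : ℝ) = 3 * x ^ 2 + 6 * x + 10 := by ring
  have hu : ((1 + x) ^ 2 - 1 : ℝ) = x * (x + 2) := by ring
  -- the identity: the model right-hand side is annihilated by the local normal form
  have hid : x * (-ψ₁ / (1 + x) + (4 / (1 + x) ^ 2 + 560 / ((7 + 3 * (1 + x) ^ 2) ^ 2 * ((1 + x) ^ 2 - 1))) * ψ₀)
      + p x * ψ₁ + q x * ψ₀ = 0 := by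
    rw [q_eq hx1 hx2, p, h7, hu]
    set t : ℝ := 3 * x ^ 2 + 6 * x + 10 with ht
    field_simp
    ring
  constructor
  · intro h
    have hsub : x * (D - (-ψ₁ / (1 + x)
        + (4 / (1 + x) ^ 2 + 560 / ((7 + 3 * (1 + x) ^ 2) ^ 2 * ((1 + x) ^ 2 - 1))) * ψ₀)) = 0 := by
      linear_combination h - hid
    rcases mul_eq_zero.1 hsub with h0 | h0
    · exact absurd h0 hx0
    · exact sub_eq_zero.1 h0
  · intro h
    rw [h]
    exact hid

end TearingFRS1

end Summit.Ventures.FusionMHD.Models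

end
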